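import Summits.QuantumFields.YangMills.Theorems.BalabanUVNodesN15KingModelSlicesTelescoped
import Summits.QuantumFields.YangMills.Theorems.BalabanUVNodesN15KingModelCurvedSlicesNode
import HarnessLib

/-!
# BalabanUVNodes ∕ N15 — THE KING-MODEL RUNG, CURVED EDITION (PART Χ-f): NE2's TYPED SITE LAYER, **FROM KING's PROPOSITION 3.9 BY NAME** —
# `NE2PlusSite (d+1) (−2) c₃₅` (and the gradient layer `(−1)`) for the family of part Χ-a's by-name Prop-3.9 data `kingSlicesTwoSpacing L k n e_M (2L^{e_M}) a m²`
# read on part D's slice carriers (`slicesInstance`, `slicesGSite`∕`slicesDGSite`), indexed by `(k, n ≥ 1, e_M, 0 ≤ j ≤ k − 1, 0 < m² ≤ m₀², Msz ≥ 1)`;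
# the hypothesis is EXACTLY part Χ-d's `prop39PrintedAt_king_zeroField` (King's printed (3.73), one `(C, δ₀, γ)` at `α = ½`), the conclusion the cell's
# typed NE2 site inequality — «NE2's analogue DECIDED in the model» from King's printed proposition, by name, hypothesis-free
# (Track A, DAG node N15 = NE2; FAN-OUT v1.1 §N15 s3 «KING-MODEL RUNG … ⇒ NE2's analogue DECIDED in the model»)

HONEST FRAMING.  Count-neutral (cell `pub-ymgap`, seat `pub-ymgap-dag-n15-e` g18; `--supports stmt-QuantumFields-27366 --as helper` = K3⁸
`SpineGivenEndpointR13SepCoPHV`).  TEMPLATE LITERATURE, `A = 0`: C. King's scalar U(1)-Higgs MODEL on finite tori ([King1986] Prop. 3.9 (3.73) p. 665); the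
typed shapes `EtaRateIneqSite` ∕ `NE2PlusSite` ([B9] Thm 3.2 (3.48) p. 398 + Thm 3.14 pp. 426–427 quantifier template) are the cell's HYPOTHESIS SHAPES — here
inhabited in the model; NOT Bałaban's covariant `G(U)`; NE2⁺ is NOT PRINTED for those and not proved; NOT a node discharge; nothing continuum ∕ ℝ⁴ ∕ OS ∕
mass-gap ∕ Clay.  0 `sorry`; THREE plumbing `def`s (`kingSlicesPB` — the point fibres of King's pairing; the index `KingSlicesIdx`; the family
`kingSlicesIndex : KingSlicesIdx d m₀² → SlicesIndex (d+1)`) — definition lane; standard axioms.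

THE CHAIN (all by name): Χ-d `prop39PrintedAt_king_zeroField` at `α = ½` ⟹ (3.73) lines 1–2 with ONE `(C, δ₀, γ)` for every member ⟹ part E
`ne2PlusSite_slicesG_of_line1` ∕ `ne2PlusSite_slicesDG_of_line2` (the typed site inequality on the slice carrier ≡ (3.73) line 1, SAME constants —
`etaRateIneqSite_slicesG_iff_line1`) ⟹ ★★★ `ne2PlusSite_kingSlices` (`p = −2`, constants `(M₅, δ, a₀, C′, γ′) = (1, δ₀, 1, C, γ)`), ★★
`ne2PlusSite_kingSlices_grad` (`p = −1`, `(d+1)·C`), `ne2ZeroSite_kingSlices`, and the ROUND TRIP `exists_line1_kingSlices` (part E's readout returns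
(3.73) line 1 above the cube-size threshold).  The members' objects are King's: by part Χ-e `sum_kingSliceG_eq_constrainedProp` the slices SUM to the full
`A = 0` propagators `G^η_k(T_η, 0)` ∕ `G^{η′}_{k+n}(T_{η′}, 0)` (recorded here as `kingSlicesIndex_sum_lo`).  The family is non-empty and its cube-size
letter is co-final (`kingSlicesIdx_nonempty`, `exists_kingSlicesIdx_M_ge`).
COMPARED WITH parts G∕M (`ne2PlusSite_kSlicesPhys`, hypothesis-free on the slice-by-slice data): the SAME inequality, now for the by-name Prop-3.9 datum of
the two Prop-3.7 data on one carrier, i.e. exactly the route «King Prop. 3.9 ⟹ NE2 site layer» a reader of the row expects.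
HONEST SCOPE: `A = 0`, periodic b.c., odd `L ≥ 3`, `a > 0`, `m₀² > 0`; one-point background sort (`NE2PlusSite ⟺ NE2ZeroSite` there, part E
`ne2PlusSite_slicesG_iff_zero`); (3.74) empty by type.  WHAT THE CURVED CASE ADDS (one line): the live quantifier `∀ U, Reg335 c₃₅ α₀ U` INSIDE one instance
for Bałaban's `G_(j)(Ω, U)` on the multiscale `𝔅` — [B9] Thm 3.14, not in the model.
Locators: [King1986] (2.17) p.653, p.664 (pairing), Prop. 3.9 (3.73) p.665; [Balaban1985BackgroundPropagators] (3.41) p.397, Thm 3.2 (3.48) p.398, Thm 3.14 pp.426–427.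
-/

noncomputable section

namespace Summit.QuantumFields.YangMills.BalabanUVNodes.N15KingModelRung.Curved

open Real Finset Matrix
open Literature.MathematicalPhysics.QuantumFieldTheory.Balaban1983to89.T4EtaRate (NE2PlusSite EtaRateIneqSite)
open Literature.MathematicalPhysics.QuantumFieldTheory.Balaban1983to89.T4EtaRateSiteOfRatePair (NE2ZeroSite)
open Literature.MathematicalPhysics.QuantumFieldTheory.Balaban1983to89.B5Prop11Plancherel (Tor fine unitVec)
open Literature.MathematicalPhysics.QuantumFieldTheory.King1986 (aK)
open Literature.MathematicalPhysics.QuantumFieldTheory.King1986.Torus (constrainedProp tdistT torCongr torCongr_refl)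
open Literature.MathematicalPhysics.QuantumFieldTheory.King1986.SlicePropagator (SliceKernels TwoSpacing Prop39PrintedAt)

variable {d : ℕ} (L : ℕ) [NeZero L]

/-! ## §1 The point fibres of King's pairing -/

section Fibres

variable {L} {k n eM : ℕ} (M : Fin (d + 1) → ℕ) [∀ μ, NeZero (M μ)] (hM : ∀ μ, M μ = 2 * L ^ eM) (hk : 1 ≤ k) (a msq : ℝ)

/-- A fine point over every coarse point: `torCongr⁻¹ (overPtN x)` lies over `x` under `kingSlicePt`. [cite: King1986, p.664 («x′ ∈ B^n(x)»)] -/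
theorem kingSlicePt_over (x : Tor (fine (L ^ k) M)) :
    kingSlicePt L k n M (torCongr (fun μ => (carrier_pow_add L k n M μ).symm) (overPtN L k n M x)) = x := by
  unfold kingSlicePt
  rw [torCongr_torCongr, torCongr_refl, underPtN_overPtN]

/-- **THE POINT FIBRES OF KING's PAIRING** on the by-name datum: `fibre x = {x′ : x′ ↦ x}` (finite, non-empty). [cite: King1986, p.664 («x′ ∈ B^n(x)»)] -/
def kingSlicesPB : PointBlocking (kingSlicesTwoSpacing L k n eM M hM hk a msq) := by
  haveI : Fintype (kingSlicesTwoSpacing L k n eM M hM hk a msq).hi.S := inferInstanceAs (Fintype (Tor (fine (L ^ (k + n)) M)))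
  haveI : DecidableEq (kingSlicesTwoSpacing L k n eM M hM hk a msq).lo.S := inferInstanceAs (DecidableEq (Tor (fine (L ^ k) M)))
  exact
    { fibre := fun x => Finset.univ.filter fun x' => (kingSlicesTwoSpacing L k n eM M hM hk a msq).pt x' = x
      mem_fibre := fun x x' => by
        rw [Finset.mem_filter]
        exact and_iff_right (Finset.mem_univ _)
      fibre_nonempty := fun x => ⟨torCongr (fun μ => (carrier_pow_add L k n M μ).symm) (overPtN L k n M x), by
        rw [Finset.mem_filter]
        exact ⟨Finset.mem_univ _, kingSlicePt_over M x⟩⟩ }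

end Fibres

/-! ## §2 The family -/

section Family

/-- THE INDEX OF THE BY-NAME FAMILY: levels `k ≥ 1`, extra steps `n ≥ 1`, cube exponent `e_M`, slice `0 ≤ j ≤ k − 1`, mass `0 < m² ≤ m₀²`, and [B9]'s
cube-size letter `Msz ≥ 1` (inert in the objects, co-final in the guard). [cite: King1986, Prop. 3.9 p.665 («0 ≤ j ≤ k − 1»); Balaban1985BackgroundPropagators, Thm 3.1 p.397 («M ≥ M₁»)] -/
structure KingSlicesIdx (d : ℕ) (m0sq : ℝ) where
  /-- levels of the coarse run -/
  k : ℕ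
  one_le_k : 1 ≤ k
  /-- extra levels of the fine run -/
  n : ℕ
  one_le_n : 1 ≤ n
  /-- the unit cube is `2L^{e_M}` -/
  eM : ℕ
  /-- the slice -/
  j : ℕ
  j_lt : j + 1 ≤ k
  /-- the mass -/
  msq : ℝ
  msq_pos : 0 < msq
  msq_le : msq ≤ m0sq
  /-- the cube-size letter -/
  Msz : ℝ
  one_le_Msz : 1 ≤ Msz

/-- The family is non-empty (for `m₀² ≥ 1`, e.g. the member `k = n = 1`, `j = 0`, `m² = 1`). [folklore] -/
theorem kingSlicesIdx_nonempty (d : ℕ) {m0sq : ℝ} (hm0 : 1 ≤ m0sq) : Nonempty (KingSlicesIdx d m0sq) :=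
  ⟨⟨1, le_rfl, 1, le_rfl, 0, 0, le_rfl, 1, one_pos, hm0, 1, le_rfl⟩⟩

/-- The cube-size letter is co-final: every threshold `M₅` is met by some member (any `k, n, e_M, j, m²`). [folklore] -/
theorem exists_kingSlicesIdx_M_ge (d : ℕ) {m0sq : ℝ} (hm0 : 1 ≤ m0sq) (M₅ : ℝ) : ∃ i : KingSlicesIdx d m0sq, M₅ ≤ i.Msz :=
  ⟨⟨1, le_rfl, 1, le_rfl, 0, 0, le_rfl, 1, one_pos, hm0, max 1 M₅, le_max_left _ _⟩, le_max_right _ _⟩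

/-- THE CUBE of a member: `M_ν = 2L^{e_M}` (all directions). [cite: King1986, (2.1) p.651 (periodic box)] -/
abbrev kingCube (eM : ℕ) : Fin (d + 1) → ℕ := fun _ => 2 * L ^ eM

/-- **THE FAMILY**: member `i` = part Χ-a's by-name datum `kingSlicesTwoSpacing L k n e_M (2L^{e_M}) a m²` with its point fibres, read at slice `j` with
cube-size letter `Msz`, as one of part D's `SlicesIndex (d+1)`. [cite: King1986, Prop. 3.9 (3.73) p.665; Balaban1985BackgroundPropagators, (3.41) p.397] -/
def kingSlicesIndex (hL : 2 ≤ L) (a : ℝ) (m0sq : ℝ) (i : KingSlicesIdx d m0sq) : SlicesIndex (d + 1) :=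
  ⟨kingSlicesTwoSpacing L i.k i.n i.eM (kingCube (d := d) L i.eM) (fun _ => rfl) i.one_le_k a i.msq,
    kingSlicesPB (kingCube (d := d) L i.eM) (fun _ => rfl) i.one_le_k a i.msq, i.j, i.j_lt, i.Msz, i.one_le_Msz, by show 1 < L; omega⟩

/-- Reading: the member's datum. [folklore] -/
theorem kingSlicesIndex_T (hL : 2 ≤ L) (a m0sq : ℝ) (i : KingSlicesIdx d m0sq) :
    (kingSlicesIndex L hL a m0sq i).T = kingSlicesTwoSpacing L i.k i.n i.eM (kingCube (d := d) L i.eM) (fun _ => rfl) i.one_le_k a i.msq := rfl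

/-- Reading: the member's slice and size letter. [folklore] -/
theorem kingSlicesIndex_j_M (hL : 2 ≤ L) (a m0sq : ℝ) (i : KingSlicesIdx d m0sq) :
    (kingSlicesIndex L hL a m0sq i).j = i.j ∧ (kingSlicesIndex L hL a m0sq i).M = i.Msz := ⟨rfl, rfl⟩

/-- **THE MEMBERS' OBJECTS ARE KING's** (part Χ-e): the coarse datum's slices of member `i` sum to the full `A = 0` propagator `G^η_k(T_η, 0)` over the
cube `2L^{e_M}` at mass `m²`. [cite: King1986, (2.17) p.653] -/
theorem kingSlicesIndex_sum_lo (hL : 2 ≤ L) {a : ℝ} (ha : 0 < a) (m0sq : ℝ) (i : KingSlicesIdx d m0sq)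
    (x y : Tor (fine (L ^ i.k) (kingCube (d := d) L i.eM))) :
    ∑ j ∈ Finset.range i.k, (kingSlicesIndex L hL a m0sq i).T.lo.G j x y
      = constrainedProp (L ^ i.k) (kingCube (d := d) L i.eM) (aK a L i.k) (((L ^ i.k : ℕ) : ℝ) ^ 2) i.msq x y :=
  sum_kingSliceG_eq_constrainedProp L hL ha i.k i.one_le_k i.eM _ (fun _ => rfl) i.msq_pos x y

end Family

/-! ## §3 NE2's site layer for the family, from Proposition 3.9 by name -/

section NE2

/-- ★★★ **NE2's TYPED SITE LAYER FOR KING's BY-NAME PROP-3.9 FAMILY** (`p = −2`, the slices): for odd `L ≥ 3`, `a > 0`, `m₀² ≥ 0` and every `c₃₅`,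
`NE2PlusSite (d+1) (−2) c₃₅` holds for the family `kingSlicesIndex L a m₀²` on part D's slice carriers — from part Χ-d `prop39PrintedAt_king_zeroField` at
`α = ½` (ONE `(C, δ₀, γ)` for all members) through part E `ne2PlusSite_slicesG_of_line1`; constants `(M₅, δ, a₀, C′, γ′) = (1, δ₀, 1, C, γ)`.
[cite: King1986, Prop. 3.9 (3.73) p.665; Balaban1985BackgroundPropagators, Thm 3.2 (3.48) p.398, Thm 3.14 pp.426–427] -/
theorem ne2PlusSite_kingSlices (hLodd : Odd L) (hL : 2 ≤ L) {a : ℝ} (ha : 0 < a) {m0sq : ℝ} (hm0 : 0 ≤ m0sq) (c35 : ℝ) :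
    NE2PlusSite (d + 1) (-2) c35 (fun i : KingSlicesIdx d m0sq => slicesInstance (kingSlicesIndex L hL a m0sq i))
      (fun i : KingSlicesIdx d m0sq => slicesGSite (kingSlicesIndex L hL a m0sq i)) := by
  obtain ⟨C, δ₀, γ, hC, hδ₀, hγ, H⟩ := prop39PrintedAt_king_zeroField (d := d) L hLodd hL ha hm0 one_half_pos one_half_lt_one
  refine ne2PlusSite_slicesG_of_line1 _ hC hδ₀ hγ (fun i x' y' => ?_) c35
  exact ((H i.k i.n i.eM i.one_le_k i.one_le_n (kingCube (d := d) L i.eM) (fun _ => rfl) i.msq i.msq_pos i.msq_le i.j i.j_lt).1 x' y').1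

/-- ★★ **THE GRADIENT LAYER** (`p = −1`, constant `(d+1)·C`): `NE2PlusSite (d+1) (−1) c₃₅` for the gradient slices of the same family (part E
`ne2PlusSite_slicesDG_of_line2` on (3.73) line 2 by name). [cite: King1986, Prop. 3.9 (3.73) p.665 (second line); Balaban1985BackgroundPropagators, Thm 3.2 (3.48) p.398] -/
theorem ne2PlusSite_kingSlices_grad (hLodd : Odd L) (hL : 2 ≤ L) {a : ℝ} (ha : 0 < a) {m0sq : ℝ} (hm0 : 0 ≤ m0sq) (c35 : ℝ) :
    NE2PlusSite (d + 1) (-1) c35 (fun i : KingSlicesIdx d m0sq => slicesInstance (kingSlicesIndex L hL a m0sq i))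
      (fun i : KingSlicesIdx d m0sq => slicesDGSite (kingSlicesIndex L hL a m0sq i)) := by
  obtain ⟨C, δ₀, γ, hC, hδ₀, hγ, H⟩ := prop39PrintedAt_king_zeroField (d := d) L hLodd hL ha hm0 one_half_pos one_half_lt_one
  refine ne2PlusSite_slicesDG_of_line2 _ (Nat.succ_pos d) hC hδ₀ hγ (fun i x' y' μ => ?_) c35
  exact ((H i.k i.n i.eM i.one_le_k i.one_le_n (kingCube (d := d) L i.eM) (fun _ => rfl) i.msq i.msq_pos i.msq_le i.j i.j_lt).1 x' y').2 μ

/-- `NE2ZeroSite` for the family (the site twin at the one configuration). [cite: King1986, Prop. 3.9 (3.73) p.665] -/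
theorem ne2ZeroSite_kingSlices (hLodd : Odd L) (hL : 2 ≤ L) {a : ℝ} (ha : 0 < a) {m0sq : ℝ} (hm0 : 0 ≤ m0sq) :
    NE2ZeroSite (d + 1) (-2) (fun i : KingSlicesIdx d m0sq => slicesInstance (kingSlicesIndex L hL a m0sq i))
        (fun i : KingSlicesIdx d m0sq => slicesGSite (kingSlicesIndex L hL a m0sq i)) ∧
      NE2ZeroSite (d + 1) (-1) (fun i : KingSlicesIdx d m0sq => slicesInstance (kingSlicesIndex L hL a m0sq i))
        (fun i : KingSlicesIdx d m0sq => slicesDGSite (kingSlicesIndex L hL a m0sq i)) :=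
  ⟨(ne2PlusSite_slicesG_iff_zero _ 0).1.mp (ne2PlusSite_kingSlices L hLodd hL ha hm0 0),
    (ne2PlusSite_slicesG_iff_zero _ 0).2.mp (ne2PlusSite_kingSlices_grad L hLodd hL ha hm0 0)⟩

/-- **THE ROUND TRIP**: the typed layer, read back by part E's readout on this family, returns King's (3.73) line 1 — a threshold `M₅` and `C′, δ, γ′ > 0`
such that every member with `Msz ≥ M₅` satisfies `|G^{η′}_{(j)}(x′, y′) − G^η_{(j)}(x, y)| ≤ C′L^{−γ′k}(L^jη)^{2−D−γ′}e^{−δ(L^jη)^{−1}|x − y|}` (the packaged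
type carries exactly the printed content). [cite: King1986, Prop. 3.9 (3.73) p.665] -/
theorem exists_line1_kingSlices (hLodd : Odd L) (hL : 2 ≤ L) {a : ℝ} (ha : 0 < a) {m0sq : ℝ} (hm0 : 0 ≤ m0sq) :
    ∃ M₅ C' δ γ' : ℝ, 0 < C' ∧ 0 < δ ∧ 0 < γ' ∧ ∀ i : KingSlicesIdx d m0sq, M₅ ≤ i.Msz →
      ∀ x' y' : Tor (fine (L ^ (i.k + i.n)) (kingCube (d := d) L i.eM)),
        |(kingSlicesIndex L hL a m0sq i).T.hi.G i.j x' y'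
            - (kingSlicesIndex L hL a m0sq i).T.lo.G i.j ((kingSlicesIndex L hL a m0sq i).T.pt x') ((kingSlicesIndex L hL a m0sq i).T.pt y')|
          ≤ C' * ((kingSlicesIndex L hL a m0sq i).T.lo.L : ℝ) ^ (-(γ' * (kingSlicesIndex L hL a m0sq i).T.lo.k))
              * ((kingSlicesIndex L hL a m0sq i).T.lo.slice i.j) ^ ((2 : ℝ) - (d + 1 : ℕ) - γ')
              * Real.exp (-(δ * ((kingSlicesIndex L hL a m0sq i).T.lo.slice i.j)⁻¹
                  * (kingSlicesIndex L hL a m0sq i).T.lo.dist ((kingSlicesIndex L hL a m0sq i).T.pt x')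
                      ((kingSlicesIndex L hL a m0sq i).T.pt y'))) :=
  exists_line1_of_ne2PlusSite_slicesG _ (ne2PlusSite_kingSlices L hLodd hL ha hm0 0)

end NE2

end Summit.QuantumFields.YangMills.BalabanUVNodes.N15KingModelRung.Curved

end
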